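import Literature.NumberTheory.GaloisCohomology.CyclotomicTowerMuKillingReal
import Literature.NumberTheory.GaloisCohomology.ArchimedeanInvariantMap
import Literature.NumberTheory.GaloisCohomology.KummerClassLocalPower
import Literature.AnabelianGeometry.AbsoluteAnabelian.AbsAnabProp121viiCupCyclicClass
import Mathlib.FieldTheory.Galois.Infinite
import Mathlib.Analysis.SpecialFunctions.Pow.Real
import HarnessLib

/-!
# The archimedean invariant of a cyclic class: `inv_w (κₙ(b) ∪ ψ) = [b <_w 0] · ψ(c_w)`

Let `K` be a number field, `n ≥ 1`, `b ∈ Kˣ`, `ψ : Γ_K ↠ ℤ/n` a cyclic character and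
`κₙ(b) ∪ ψ ∈ H²(Γ_K, μₙ)` the cyclic class (cup product of the Kummer class of `b` with
`σ ↦ (ψ σ)·id ∈ μₙ^∨(1)`).  At a REAL place `w` of `K`, with `Γ_{K_w} = {1, c}` and `c_w = res c ∈ Γ_K`
the attached complex conjugation, the archimedean invariant map of the tree
(`archimedeanInvariantMap`, the injection `H²(K_w, μₙ) = Br(ℝ)[n] ↪ ℤ/n`, values in `{0, n/2}`) takes
on the localisation of the cyclic class the value

  `inv_w (loc_w (κₙ(b) ∪ ψ)) = ψ(c_w)` if `b <_w 0`,   and `loc_w (κₙ(b) ∪ ψ) = 0` if `b >_w 0`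

— the archimedean case of Serre's formula `inv(χ, b) = χ((b, L/K))` (*Corps locaux* XIV §1 Prop. 3)
for the norm residue symbol of `K_w = ℝ`: `(b, ℂ/ℝ)` is complex conjugation iff `b < 0` (Neukirch VI
(5.6); Cassels–Fröhlich VII §6.3).  Cocycle-level proof: the localisation is the class of
`(σ, τ) ↦ (ψ τ)·(σβ/β)` (`β` an `n`-th root of `b`); its diagonal (`twoCocycleDiagonal`, the tree's
recipe for `inv_w`) is `(ψ c_w)·(cβ/β)`; `ψ(c_w)` is `2`-torsion, and when it is `n/2` the diagonal is
`(cβ/β)^{n/2} = cγ/γ` for `γ = β^{n/2}`, `γ² = b`, which is `-1` exactly when `γ ∉ K_w`, i.e. when `b` is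
not a square of `K_w ≅ ℝ`, i.e. `b <_w 0`.

* `exists_pow_eq_of_pos`, `exists_pow_eq_of_isComplex` — positive elements of `K_w ≅ ℝ`, resp. all
  units of `K_w ≅ ℂ`, are `n`-th powers;
* `localization_inl_δ₀_baseUnitsInvariant_eq_zero_of_eq_pow`, `localization_inl_cupProduct_δ₀_eq_zero_of_eq_pow`,
  `…_of_pos`, `…_of_isComplex` — **`loc_w κₙ(b) = 0` and `loc_w (κₙ(b) ∪ y) = 0` for `b` an `n`-th
  power in `K_w`**, in particular for `b >_w 0` at a real place and always at a complex place
  (infinite-place twin of `localization_cupProduct_δ₀_eq_zero_of_eq_pow`);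
* **`archimedeanInvariantMap_localization_cupProduct_δ₀_of_neg`** — for `b <_w 0`:
  `inv_w (loc_w (κₙ(b) ∪ ψ)) = ψ (res c)` for the non-trivial `c ∈ Γ_{K_w}`.

Node (N3) of the `∀ K` form of `poitouTate_sum_localTatePairing_eq_zero` (cell `bsd-cn100`, seat
transfer-2 g5): the archimedean terms of the reciprocity law for cyclic classes.  Proof file:
theorems only (no definition, no named fact, no instance; D-0026).  HONEST FRAMING: textbook local
class field theory at `ℝ`; proves no case of BSD.

## References

* J.-P. Serre, *Corps locaux* / *Local Fields* (1979), XIV §1 Prop. 3 (`inv(χ, b) = χ((b, L/K))`),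
  XIII §3 Remarque (the case `K = ℝ`). [SerreLocalFields1979]
* J. Neukirch, *Algebraic Number Theory* (1999), Ch. VI §5 (5.6) (the norm residue symbol over `ℝ`).
  [NeukirchANT1999]
* J. S. Milne, *Arithmetic Duality Theorems* (2006), I Ex. 1.6 (c), Thm. 2.13. [MilneADT2006]

## Tree search

`lean search 'archimedeanInvariantMap.*cupProduct|localization_inl|of_neg.*cupProduct'`: nothing;
finite-place analogues `localInvariantMap_localization_cupProduct_δ₀` (T-loc) and
`localization_cupProduct_δ₀_eq_zero_of_eq_pow` (Hensel).  Inputs: `archimedeanInvariantMap_twoCocycleClass`,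
`twoCocycleDiagonal_of_ne_one`, `ContPairing.cupCocycle_apply_eq_smul`, `tateDual_scalarEnd`,
`IsSES.δ₀_apply_eq`/`f_δ₀Cocycle_apply`, `resMu_eq_of_localization_inl`,
`resMu_δ₀_baseUnitsInvariant_eq_zero_of_eq_pow`, Mathlib `InfiniteGalois.mem_range_algebraMap_iff_fixed`.
-/

noncomputable section

open CategoryTheory Function Field NumberField IsDedekindDomain
open scoped NumberField

universe u

namespace Literature.NumberTheory.GaloisCohomology

open _root_.TopRep _root_.ContRepresentation _root_.ContinuousCohomology
open Literature.NumberTheory.GaloisRepresentations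
open Literature.NumberTheory.GaloisRepresentations.DiscreteGaloisModule
open Literature.NumberTheory.GaloisRepresentations.LocalWeilDatum
open Literature.AnabelianGeometry.AbsoluteAnabelian
open Literature.AnabelianGeometry.AbsoluteAnabelian.Prop121vii

/-! ### §1. The element of order two of `ℤ/n` -/

/-- **The only element of order dividing `2` other than `0` in `ℤ/n` is `n/2` (and then `n` is
even).** [folklore] -/
private theorem ZMod.eq_natCast_div_two_of_two_nsmul_eq_zero {n : ℕ} [NeZero n] (x : ZMod n)
    (h2 : 2 • x = 0) (h0 : x ≠ 0) : x = ((n / 2 : ℕ) : ZMod n) ∧ 2 ∣ n := by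
  have hlt : x.val < n := ZMod.val_lt x
  have hpos : 0 < x.val := Nat.pos_of_ne_zero fun h => h0 ((ZMod.val_eq_zero x).mp h)
  have h2' : ((2 * x.val : ℕ) : ZMod n) = 0 := by
    rw [two_mul, Nat.cast_add, ZMod.natCast_zmod_val, ← two_nsmul]
    exact h2
  have hdvd : n ∣ 2 * x.val := (ZMod.natCast_eq_zero_iff _ _).mp h2'
  obtain ⟨k, hk⟩ := hdvd
  have hk1 : k = 1 := by
    rcases Nat.lt_or_ge k 2 with hk2 | hk2
    · interval_cases k
      · omega
      · rfl
    · have : n * 2 ≤ n * k := Nat.mul_le_mul_left n hk2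
      omega
  subst hk1
  rw [mul_one] at hk
  refine ⟨?_, ⟨x.val, by omega⟩⟩
  have hv : x.val = n / 2 := by omega
  rw [← hv, ZMod.natCast_zmod_val]

/-- An additive isomorphism onto `ℤ/n` sends a non-zero element killed by `2` to `n/2`. [folklore] -/
private theorem AddEquiv.apply_eq_natCast_div_two {A : Type*} [AddCommGroup A] {n : ℕ} [NeZero n]
    (e : A ≃+ ZMod n) {a : A} (h2 : 2 • a = 0) (h0 : a ≠ 0) : e a = ((n / 2 : ℕ) : ZMod n) :=
  (ZMod.eq_natCast_div_two_of_two_nsmul_eq_zero (e a) (by rw [← map_nsmul, h2, map_zero])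
    (by rw [ne_eq, e.map_eq_zero_iff]; exact h0)).1

/-! ### §2. `n`-th powers in `K_w` -/

section Powers

variable {K : Type u} [Field K] {n : ℕ} [NeZero n]

/-- **A positive element of `K_w ≅ ℝ` is an `n`-th power** (`ℝ_{>0}` is divisible: `t = x^{1/n}`).
[cite: NeukirchANT1999, Ch. VI §5 Prop. (5.6)] -/
theorem exists_pow_eq_of_pos {w : InfinitePlace K} (hw : w.IsReal) (x : w.Completion)
    (hx : 0 < InfinitePlace.Completion.extensionEmbeddingOfIsReal hw x) : ∃ t : w.Completion, x = t ^ n := by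
  set e : w.Completion ≃+* ℝ := InfinitePlace.Completion.ringEquivRealOfIsReal hw with he
  have hex : e x = InfinitePlace.Completion.extensionEmbeddingOfIsReal hw x := rfl
  set s : ℝ := e x with hs
  have hs0 : 0 ≤ s := by rw [hex]; exact hx.le
  refine ⟨e.symm (s ^ ((n : ℝ)⁻¹)), e.injective ?_⟩
  rw [map_pow, RingEquiv.apply_symm_apply, Real.rpow_inv_natCast_pow hs0 (NeZero.ne n)]

omit [NeZero n] in
/-- **Every unit of `K_w ≅ ℂ` is an `n`-th power** (`ℂ` is algebraically closed), `n ≥ 1`.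
[cite: NeukirchANT1999, Ch. VI §5 Prop. (5.6)] -/
theorem exists_pow_eq_of_isComplex {w : InfinitePlace K} (hw : w.IsComplex) (hn : 0 < n) (x : w.Completion) :
    ∃ t : w.Completion, x = t ^ n := by
  set e : w.Completion ≃+* ℂ := InfinitePlace.Completion.ringEquivComplexOfIsComplex hw with he
  obtain ⟨z, hz⟩ := IsAlgClosed.exists_pow_nat_eq (e x) hn
  refine ⟨e.symm z, e.injective ?_⟩
  rw [map_pow, RingEquiv.apply_symm_apply, hz]

end Powers

/-! ### §3. `loc_w κₙ(b) = 0` for `b` an `n`-th power in `K_w` -/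

section LocalPower

variable {K : Type} [Field K] [NumberField K] {n : ℕ} [NeZero n] (w : InfinitePlace K)

/-- **`loc_w κₙ(x) = 0` when `x` is an `n`-th power in `K_w`** (infinite place `w`): transported along
`μₙ(K̄)| ≅ μₙ(K̄_w)` (the `muTransfer` isomorphism, `resMu_eq_of_localization_inl`) the localisation is
the Kummer class of `x` in `K_w` (`resMu_δ₀_baseUnitsInvariant`), which vanishes
(`resMu_δ₀_baseUnitsInvariant_eq_zero_of_eq_pow`).  Infinite-place twin of
`localization_δ₀_baseUnitsInvariant_eq_zero_of_eq_pow`. [cite: SerreGaloisCohomology1997, II §1.2] -/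
theorem localization_inl_δ₀_baseUnitsInvariant_eq_zero_of_eq_pow (x : K) (hx : x ≠ 0)
    {t : w.Completion} (ht : algebraMap K w.Completion x = t ^ n) :
    haveI : CompactSpace (absoluteGaloisGroup K) := absoluteGaloisGroup_compactSpace K
    haveI : CompactSpace (absoluteGaloisGroup w.Completion) := absoluteGaloisGroup_compactSpace _
    galoisCohomology.localization (mu K n) (Sum.inl w) 1
      ((isSES_kummer K n (NeZero.pos n)).δ₀ (baseUnitsInvariant K x hx)) = 0 := by
  haveI : CompactSpace (absoluteGaloisGroup K) := absoluteGaloisGroup_compactSpace K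
  haveI : CompactSpace (absoluteGaloisGroup w.Completion) := absoluteGaloisGroup_compactSpace _
  haveI : CharZero w.Completion := charZero_of_injective_algebraMap (algebraMap K w.Completion).injective
  -- the transfer isomorphism `μₙ(K̄)| ≅ μₙ(K̄_w)`
  let isoW : ((mu K n).restrict (absGaloisRestrict K w.Completion)).toTopRep ≅ (mu w.Completion n).toTopRep :=
    topRepIsoOfEquiv (X := ((mu K n).restrict (absGaloisRestrict K w.Completion)).toTopRep)
      (Y := (mu w.Completion n).toTopRep)
      { (muTransferEquiv K w.Completion n).toIntLinearEquiv with
        continuous_toFun := continuous_of_discreteTopology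
        continuous_invFun := continuous_of_discreteTopology }
      fun σ y => muTransfer_mu K w.Completion n σ y
  have hinj : Injective (fun c => (cohomologyMap isoW.hom 1).hom c) :=
    (continuousCohomologyEquivOfIso isoW 1).injective
  apply hinj
  change (cohomologyMap isoW.hom 1).hom (galoisCohomology.localization (mu K n) (Sum.inl w) 1 _) =
    (cohomologyMap isoW.hom 1).hom 0
  rw [map_zero, resMu_eq_of_localization_inl w 1 _ isoW.hom (fun _ => rfl)]
  exact resMu_δ₀_baseUnitsInvariant_eq_zero_of_eq_pow K w.Completion x hx ht

/-- **`loc_w (κₙ(x) ∪ y) = 0` for every `y` when `x` is an `n`-th power in `K_w`** (localisation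
commutes with cup products, `LocalInvariants.localization_cupProduct`). [cite: SerreGaloisCohomology1997, II §1.2] -/
theorem localization_inl_cupProduct_δ₀_eq_zero_of_eq_pow (x : K) (hx : x ≠ 0)
    {t : w.Completion} (ht : algebraMap K w.Completion x = t ^ n)
    (y : galoisCohomology ((mu K n).tateDual n) 1) :
    haveI : CompactSpace (absoluteGaloisGroup K) := absoluteGaloisGroup_compactSpace K
    haveI : CompactSpace (absoluteGaloisGroup w.Completion) := absoluteGaloisGroup_compactSpace _
    galoisCohomology.localization (mu K n) (Sum.inl w) 2
      (((mu K n).tateDualPairing n).cupProduct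
        ((isSES_kummer K n (NeZero.pos n)).δ₀ (baseUnitsInvariant K x hx)) y) = 0 := by
  haveI : CompactSpace (absoluteGaloisGroup K) := absoluteGaloisGroup_compactSpace K
  haveI : CompactSpace (absoluteGaloisGroup (Place.Completion (K := K) (Sum.inl w))) :=
    absoluteGaloisGroup_compactSpace _
  rw [LocalInvariants.localization_cupProduct,
    localization_inl_δ₀_baseUnitsInvariant_eq_zero_of_eq_pow w x hx ht, map_zero, AddMonoidHom.zero_apply]

/-- **At a real place where `b >_w 0`, `loc_w (κₙ(b) ∪ y) = 0` for every `y`** (positive reals are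
`n`-th powers; the norm residue symbol over `ℝ` kills `ℝ_{>0}`). [cite: NeukirchANT1999, Ch. VI §5 Prop. (5.6)] -/
theorem localization_inl_cupProduct_δ₀_eq_zero_of_pos {w : InfinitePlace K} (hw : w.IsReal) (x : K)
    (hx : x ≠ 0) (hpos : 0 < InfinitePlace.Completion.extensionEmbeddingOfIsReal hw (algebraMap K w.Completion x))
    (y : galoisCohomology ((mu K n).tateDual n) 1) :
    haveI : CompactSpace (absoluteGaloisGroup K) := absoluteGaloisGroup_compactSpace K
    haveI : CompactSpace (absoluteGaloisGroup w.Completion) := absoluteGaloisGroup_compactSpace _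
    galoisCohomology.localization (mu K n) (Sum.inl w) 2
      (((mu K n).tateDualPairing n).cupProduct
        ((isSES_kummer K n (NeZero.pos n)).δ₀ (baseUnitsInvariant K x hx)) y) = 0 := by
  obtain ⟨t, ht⟩ := exists_pow_eq_of_pos (n := n) hw _ hpos
  exact localization_inl_cupProduct_δ₀_eq_zero_of_eq_pow w x hx ht y

/-- **At a complex place `loc_w (κₙ(b) ∪ y) = 0`** for every `b`, `y` (everything is an `n`-th power
in `ℂ`; indeed `H²(K_w, μₙ) = 0`). [cite: NeukirchANT1999, Ch. VI §5 Prop. (5.6)] -/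
theorem localization_inl_cupProduct_δ₀_eq_zero_of_isComplex {w : InfinitePlace K} (hw : w.IsComplex)
    (x : K) (hx : x ≠ 0) (y : galoisCohomology ((mu K n).tateDual n) 1) :
    haveI : CompactSpace (absoluteGaloisGroup K) := absoluteGaloisGroup_compactSpace K
    haveI : CompactSpace (absoluteGaloisGroup w.Completion) := absoluteGaloisGroup_compactSpace _
    galoisCohomology.localization (mu K n) (Sum.inl w) 2
      (((mu K n).tateDualPairing n).cupProduct
        ((isSES_kummer K n (NeZero.pos n)).δ₀ (baseUnitsInvariant K x hx)) y) = 0 := by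
  obtain ⟨t, ht⟩ := exists_pow_eq_of_isComplex (n := n) hw (NeZero.pos n) (algebraMap K w.Completion x)
  exact localization_inl_cupProduct_δ₀_eq_zero_of_eq_pow w x hx ht y

end LocalPower

/-! ### §4. The evaluation at a real place where `b <_w 0` -/

section Negative

variable {K : Type} [Field K] [NumberField K] {n : ℕ} [NeZero n]

/-- `-1 ≠ 1` in `K̄ˣ` (characteristic `0`). [folklore] -/
private theorem neg_one_ne_one_units (F : Type*) [Field F] [CharZero F] : (-1 : Fˣ) ≠ 1 := by
  intro h
  have h' : ((-1 : Fˣ) : F) = ((1 : Fˣ) : F) := by rw [h]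
  rw [Units.val_neg, Units.val_one] at h'
  have : (2 : F) = 0 := by linear_combination -h'
  exact two_ne_zero this

/-- A unit of a field with square `1`, other than `1`, is `-1`. [folklore] -/
private theorem units_eq_neg_one_of_sq_eq_one {F : Type*} [Field F] {x : Fˣ} (h : x ^ 2 = 1) (h1 : x ≠ 1) :
    x = -1 := by
  have h' : (x : F) * (x : F) = 1 := by rw [← pow_two, ← Units.val_pow_eq_pow_val, h, Units.val_one]
  rcases mul_self_eq_one_iff.mp h' with h'' | h''
  · exact absurd (Units.ext h'') h1
  · exact Units.ext (by rw [h'', Units.val_neg, Units.val_one])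

/-- **`inv_w (loc_w (κₙ(b) ∪ ψ)) = ψ(c_w)` at a real place `w` where `b <_w 0`.**  For the
non-trivial element `c` of `Γ_{K_w}` (a real place: `exists_ne_one_absoluteGaloisGroup_of_isReal`) and
`c_w = res c ∈ Γ_K` its image: the archimedean invariant of the localisation of the cyclic class
`κₙ(b) ∪ [ψ·id]` is `ψ(c_w)` (an element of `{0, n/2}`, `c_w² = 1`).  This is Serre's
`inv(χ, b) = χ((b, L/K))` at `K_w = ℝ` with `(b, ℂ/ℝ) =` complex conjugation for `b < 0`; see the
module docstring for the cocycle computation. [cite: SerreLocalFields1979, XIV §1 Prop. 3]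
[cite: NeukirchANT1999, Ch. VI §5 Prop. (5.6)] -/
theorem archimedeanInvariantMap_localization_cupProduct_δ₀_of_neg {w : InfinitePlace K} (hw : w.IsReal)
    (ψ : CyclicCharacter (absoluteGaloisGroup K) n) (b : K) (hb : b ≠ 0)
    (hneg : InfinitePlace.Completion.extensionEmbeddingOfIsReal hw (algebraMap K w.Completion b) < 0)
    {c : absoluteGaloisGroup (Place.Completion (K := K) (Sum.inl w))} (hc : c ≠ 1) :
    haveI : CompactSpace (absoluteGaloisGroup K) := absoluteGaloisGroup_compactSpace K
    haveI : CompactSpace (absoluteGaloisGroup (Place.Completion (K := K) (Sum.inl w))) :=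
      absoluteGaloisGroup_compactSpace _
    archimedeanInvariantMap K n w (galoisCohomology.localization (mu K n) (Sum.inl w) 2
      (((mu K n).tateDualPairing n).cupProduct
        ((isSES_kummer K n (NeZero.pos n)).δ₀ (baseUnitsInvariant K b hb))
        (oneCocycleClass _ (scalarCocycle ψ)))) =
      ψ (absGaloisRestrict K (Place.Completion (K := K) (Sum.inl w)) c) := by
  classical
  haveI : CompactSpace (absoluteGaloisGroup K) := absoluteGaloisGroup_compactSpace K
  haveI : CompactSpace (absoluteGaloisGroup (Place.Completion (K := K) (Sum.inl w))) :=
    absoluteGaloisGroup_compactSpace _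
  haveI := finite_absoluteGaloisGroup_placeCompletion_inl K w
  haveI : CharZero (Place.Completion (K := K) (Sum.inl w)) :=
    charZero_of_injective_algebraMap (algebraMap K _).injective
  haveI : IsGalois (Place.Completion (K := K) (Sum.inl w)) (AlgebraicClosure (Place.Completion (K := K) (Sum.inl w))) := {}
  have hG := natCard_absoluteGaloisGroup_placeCompletion_inl_le_two K w
  have hn : 0 < n := NeZero.pos n
  set res := absGaloisRestrict K (Place.Completion (K := K) (Sum.inl w)) with hres
  set cK : absoluteGaloisGroup K := res c with hcK
  -- an `n`-th root `wr` of `b` in `K̄ˣ` (additive notation)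
  set u := baseUnitsInvariant K b hb with hu
  obtain ⟨wr, hwr⟩ := (isSES_kummer K n hn).surjective (u : UnitsCarrier K)
  have hwinv : (kummerπ K n).hom wr ∈ (units K).toTopRep.ρ.invariants := by rw [hwr]; exact u.2
  set f := (isSES_kummer K n hn).δ₀Cocycle wr hwinv with hf
  set g := scalarCocycle ψ with hg
  -- the cup-product cocycle `(σ, τ) ↦ (ψ τ) · f σ` and its pull-back to `Γ_{K_w}`
  set C := ((mu K n).tateDualPairing n).cupCocycle f g with hCdef
  have hC : ∀ σ τ, C.1 (σ, τ) = (((ψ τ).val : ℤ)) • f.1 σ := by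
    intro σ τ
    rw [hCdef, ContPairing.cupCocycle_apply_eq_smul, ContinuousRep.toTopRep_ρ_apply]
    have hgτ : (mu K n).tateDual n σ (g.1 τ) = g.1 τ := tateDual_scalarEnd K σ (ψ τ)
    rw [hgτ]
    change g.1 τ (f.1 σ) = _
    rw [hg, scalarCocycle_apply]
    rfl
  set P : contTwoCocycles ((mu K n).toLocal (Sum.inl w)).toTopRep := contTwoCocycles.pullback res
    (TopRep.ofHom ⟨ContinuousLinearMap.id ℤ (MuCarrier K n), fun _ => rfl⟩) C with hPdef
  have hP : ∀ x y, P.1 (x, y) = C.1 (res x, res y) := fun _ _ => rfl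
  -- the localisation as the class of the pulled-back cocycle, and its diagonal
  have hloc : galoisCohomology.localization (mu K n) (Sum.inl w) 2
      (((mu K n).tateDualPairing n).cupProduct
        ((isSES_kummer K n hn).δ₀ (baseUnitsInvariant K b hb)) (oneCocycleClass _ g)) =
      twoCocycleClass ((mu K n).toLocal (Sum.inl w)).toTopRep P := by
    rw [← hu, (isSES_kummer K n hn).δ₀_apply_eq u wr hwr, ← hf,
      ContPairing.cupProduct_oneCocycleClass_eq_twoCocycleClass, ← hCdef, hPdef]
    exact map_twoCocycleClass (Y := ((mu K n).toLocal (Sum.inl w)).toTopRep) (mu K n).toTopRep res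
      (TopRep.ofHom ⟨ContinuousLinearMap.id ℤ (MuCarrier K n), fun _ => rfl⟩) C
  rw [hloc, archimedeanInvariantMap_twoCocycleClass (K := K) (n := n) (w := w) P,
    twoCocycleDiagonal_of_ne_one (X := ((mu K n).toLocal (Sum.inl w)).toTopRep) hG hc P, hP, hP, map_one,
    ← hcK, hC, hC, ψ.map_one, ZMod.val_zero, Nat.cast_zero, zero_smul, add_zero]
  -- `ψ cK` is `2`-torsion
  have hc2 : c * c = 1 := mul_self_eq_one_of_natCard_le_two hG c
  have hψ2 : 2 • ψ cK = 0 := by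
    rw [two_nsmul, ← ψ.map_mul, hcK, ← map_mul, hc2, map_one, ψ.map_one]
  by_cases hψ0 : ψ cK = 0
  · rw [hψ0, ZMod.val_zero, Nat.cast_zero, zero_smul, map_zero]
  obtain ⟨hψ, n2⟩ := ZMod.eq_natCast_div_two_of_two_nsmul_eq_zero (ψ cK) hψ2 hψ0
  have hval : (ψ cK).val = n / 2 := by
    rw [hψ, ZMod.val_natCast, Nat.mod_eq_of_lt (Nat.div_lt_self hn one_lt_two)]
  rw [hval, natCast_zsmul, hψ]
  -- the diagonal `D = (n/2) • f cK` has `muVal D = (c γ)/γ`, `γ = β^{n/2}`, `γ² = b`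
  set β : (AlgebraicClosure K)ˣ := unitsVal K wr with hβ
  have hβn : β ^ n = unitsVal K (u : UnitsCarrier K) := by
    rw [hβ, ← hwr, kummerπ_hom_apply, unitsVal_zsmul, zpow_natCast]
  have hβnK : ((β ^ n : (AlgebraicClosure K)ˣ) : AlgebraicClosure K) = algebraMap K (AlgebraicClosure K) b := by
    rw [hβn, hu, coe_unitsVal_baseUnitsInvariant]
  have hfval : muVal K n (f.1 cK) = cK • β / β := by
    have h := congrArg (unitsVal K) ((isSES_kummer K n hn).f_δ₀Cocycle_apply wr hwinv cK)
    rw [unitsVal_kummerι] at h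
    rw [h, sub_eq_add_neg, unitsVal_add, unitsVal_apply, div_eq_mul_inv]
    rfl
  set γ : (AlgebraicClosure K)ˣ := β ^ (n / 2) with hγ
  have hγ2 : γ ^ 2 = β ^ n := by
    rw [hγ, ← pow_mul, Nat.div_mul_cancel n2]
  have hD : muVal K n ((n / 2) • f.1 cK) = cK • γ / γ := by
    rw [muVal_nsmul, hfval, div_pow, hγ, smul_pow']
  -- `(cγ/γ)² = 1`: `β^n = b` is `Γ_K`-invariant
  have hinv : cK • (β ^ n) = β ^ n := by
    rw [hβn, ← unitsVal_apply]
    exact congrArg (unitsVal K) (u.2 cK)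
  have hsq : (cK • γ / γ) ^ 2 = 1 := by
    rw [div_pow, ← smul_pow', hγ2, hinv, div_self']
  -- `cγ ≠ γ`: otherwise `γ` lands in `K_w` and `b = γ²` would be a square of `K_w ≅ ℝ`
  have hne : cK • γ / γ ≠ 1 := by
    intro h1
    rw [div_eq_one] at h1
    -- `ι γ` is fixed by `Γ_{K_w} = {1, c}`
    set ι := absClosureEmbedding K (Place.Completion (K := K) (Sum.inl w)) with hι
    have hfix : ∀ σ : absoluteGaloisGroup (Place.Completion (K := K) (Sum.inl w)),
        σ • ι (γ : AlgebraicClosure K) = ι (γ : AlgebraicClosure K) := by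
      intro σ
      rcases eq_or_ne σ 1 with rfl | hσ
      · rw [one_smul]
      · obtain rfl : σ = c := eq_of_ne_one_of_natCard_le_two hG hσ hc
        rw [← absGaloisRestrict_apply_smul, ← hres, ← hcK, ← Units.coe_smul, h1]
    obtain ⟨z, hz⟩ := (InfiniteGalois.mem_range_algebraMap_iff_fixed (ι (γ : AlgebraicClosure K))).mpr
      fun σ => hfix σ
    -- `z² = b` in `K_w`
    have hz2 : z ^ 2 = algebraMap K (Place.Completion (K := K) (Sum.inl w)) b := by
      apply (algebraMap (Place.Completion (K := K) (Sum.inl w))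
        (AlgebraicClosure (Place.Completion (K := K) (Sum.inl w)))).injective
      rw [map_pow, hz, ← map_pow, ← Units.val_pow_eq_pow_val, hγ2, hβnK, AlgHom.commutes,
        IsScalarTower.algebraMap_apply K (Place.Completion (K := K) (Sum.inl w))
          (AlgebraicClosure (Place.Completion (K := K) (Sum.inl w)))]
    obtain ⟨z', hz2'⟩ : ∃ z' : w.Completion, z' ^ 2 = algebraMap K w.Completion b := ⟨z, hz2⟩
    have h0 : 0 ≤ InfinitePlace.Completion.extensionEmbeddingOfIsReal hw (algebraMap K w.Completion b) := by
      rw [← hz2', map_pow]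
      exact sq_nonneg _
    exact absurd hneg (not_lt.mpr h0)
  have hm1 : cK • γ / γ = -1 := units_eq_neg_one_of_sq_eq_one hsq hne
  -- hence `D ≠ 0`, `2 • D = 0`, and the invariant is `n/2`
  have hD0 : (n / 2) • f.1 cK ≠ 0 := by
    intro h0
    have h := congrArg (muVal K n) h0
    rw [hD, hm1, muVal_zero] at h
    exact neg_one_ne_one_units (AlgebraicClosure K) h
  have hD2 : 2 • ((n / 2) • f.1 cK) = 0 := by
    rw [← mul_nsmul', Nat.mul_div_cancel' n2]
    apply muVal_injective K n
    rw [muVal_nsmul, muVal_pow_eq_one, muVal_zero]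
  exact AddEquiv.apply_eq_natCast_div_two (muCarrierZModEquiv K n) hD2 hD0

/-- **Real places, summary**: at a real place `w` with non-trivial `c ∈ Γ_{K_w}`, for every `b ∈ Kˣ`,
`inv_w (loc_w (κₙ(b) ∪ ψ))` is `ψ (res c)` if `b <_w 0` and `0` if `b >_w 0`
(the archimedean case of `inv(χ, b) = χ((b, L/K))`). [cite: SerreLocalFields1979, XIV §1 Prop. 3] -/
theorem archimedeanInvariantMap_localization_cupProduct_δ₀_of_isReal {w : InfinitePlace K} (hw : w.IsReal)
    (ψ : CyclicCharacter (absoluteGaloisGroup K) n) (b : K) (hb : b ≠ 0)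
    {c : absoluteGaloisGroup (Place.Completion (K := K) (Sum.inl w))} (hc : c ≠ 1) :
    haveI : CompactSpace (absoluteGaloisGroup K) := absoluteGaloisGroup_compactSpace K
    haveI : CompactSpace (absoluteGaloisGroup (Place.Completion (K := K) (Sum.inl w))) :=
      absoluteGaloisGroup_compactSpace _
    archimedeanInvariantMap K n w (galoisCohomology.localization (mu K n) (Sum.inl w) 2
      (((mu K n).tateDualPairing n).cupProduct
        ((isSES_kummer K n (NeZero.pos n)).δ₀ (baseUnitsInvariant K b hb))
        (oneCocycleClass _ (scalarCocycle ψ)))) =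
      if InfinitePlace.Completion.extensionEmbeddingOfIsReal hw (algebraMap K w.Completion b) < 0 then
        ψ (absGaloisRestrict K (Place.Completion (K := K) (Sum.inl w)) c) else 0 := by
  split_ifs with h
  · exact archimedeanInvariantMap_localization_cupProduct_δ₀_of_neg hw ψ b hb h hc
  · have hne : InfinitePlace.Completion.extensionEmbeddingOfIsReal hw (algebraMap K w.Completion b) ≠ 0 := by
      rw [map_ne_zero_iff _ (InfinitePlace.Completion.extensionEmbeddingOfIsReal hw).injective,
        map_ne_zero_iff _ (algebraMap K w.Completion).injective]
      exact hb
    have hpos : 0 < InfinitePlace.Completion.extensionEmbeddingOfIsReal hw (algebraMap K w.Completion b) :=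
      lt_of_le_of_ne (not_lt.mp h) hne.symm
    have h0 := localization_inl_cupProduct_δ₀_eq_zero_of_pos (n := n) hw b hb hpos
      (oneCocycleClass _ (scalarCocycle ψ))
    rw [h0, map_zero]

end Negative

end Literature.NumberTheory.GaloisCohomology

end
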